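/-
Copyright (c) 2026 the pub-hodgecm-mathlib formalisation cell (harness21).  Prover seat hodgecm-mathlib-K2Liu-p01 (g8), Track B «K2-LIT»,
#184♮ = hLiu418 = `stmt-HodgeConjecture-24832`; #42S organ S1 ROAD W, inert∕split∕ramified witness TOP FILE part (W1-a) (RECIPE-F7-InertWitnessTopFile 80571dd96a2cf31d §C):
the socket binder `hf₀inv` COMPOSED at the tensor datum, place-generic — `F_Φ(h · n(t)) = F_Φ(h)` as soon as the Rao phase of `t ⊗ 1` lies in the conductor on `supp ΓΦ`.
-/
import Summits.HodgeConjecture.HodgeConjecture.Theorems.K2LiuLocalSWTensorBigCellLetters     -- ★ F4b `tensorEmbLoc_nElem`, `skew_reindex_kronecker_one` (+ F4a, D-A v1)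
import Summits.HodgeConjecture.HodgeConjecture.Theorems.K2LiuLocalSWBigCellWords            -- ★ F4a-1 `implementer_localOmega_nElem_apply`, `parabolicAtUnipotents_localSplittingDatumCM`
import Summits.HodgeConjecture.HodgeConjecture.Theorems.K2LiuWitnessUnipotentInvariance      -- ★ (H) `eq_self_of_implementer`, `unipOpPi_eq_self_of_support`
import HarnessLib

/-!
# Crux `HLiu418`, #42S-S1 ROAD W, (W1-a): `hf₀inv` AT THE TENSOR DATUM — `F_Φ(h · n(t)) = F_Φ(h)` from the phase bound on `supp ΓΦ`

Cell `hodgecm-mathlib`, crux item hLiu418 = `stmt-HodgeConjecture-24832` (helper lane `--supports … --as helper`, count-neutral).  THEOREMS ONLY (no `def`, no instance,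
no notation, no named-fact hypothesis, no `sorry`).  PLACE-GENERIC (any finite `v`; the tensor currency `(L e dV dW eW e′ dV′)` of ★ F4b ∕ ★ F5c-A).

THE COMPOSITION (SPEC-S1-AssemblySocket row `hf₀inv`; RECIPE §C).  For Kudla's CM splitting `D := localSplittingDatumCM` of the BIG doubled group and the Siegel–Weil section
`F_Φ = swSectionTensorLoc … D.localSplitting m₀ Φ` on the SMALL group: ★ `swSectionTensorLoc_mul_right` gives `F_Φ(h·n(t)) = F_{ω_D(ι⊗(n(t)))Φ}(h)`, ★ F4b `tensorEmbLoc_nElem`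
reads `ι⊗(n(t)) = n′(t ⊗ 1)`, ★ F4a-1 `implementer_localOmega_nElem_apply` (with ★ `parabolicAtUnipotents_localSplittingDatumCM`) gives `Γ(ω_D(n′)Φ) = r(n(c))(ΓΦ)` for any
mover-implementer `(E′, Γ)`, and ★ (H) `unipOpPi_eq_self_of_support` + `eq_self_of_implementer` give `ω_D(n′)Φ = Φ` as soon as `½⟨x, c x⟩ ∈ 𝔭^{m_ψ}` on a set `K ⊇ supp ΓΦ`
(BY VALUE here: `hphase`; discharged by ★ (T3a) + ★ κ-comp (K2) + ★ (Φ8) + ★ `mul_mem_primePowBall_iff` in (W1-b)).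
* **`localOmega_nElem_eq_self`** — `ω_D(n′(T)) Φ = Φ` from `hsupp` + `hphase`;   * **`swSectionTensorLoc_mul_nElem_eq_self`** — the `hf₀inv` shape `F_Φ(h·n(t)) = F_Φ(h)`.
[Kudla1994, §3 Thm. 3.1] [MoeglinVignerasWaldspurger1987, Chap. 2 II.6] [HarrisKudlaSweet1996, §1 (1.15)] [Rangarao1993, Lemma 3.2].
HONEST LABEL.  Count-neutral helper; `HC_CM` is proved only modulo the 7 printed citations (2 remaining named inputs: hLiu418 = `stmt-HodgeConjecture-24832`,
h413 = `stmt-HodgeConjecture-24833`) until rung 0 closes.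

## References
* [Kudla1994] S. S. Kudla, *Splitting metaplectic covers of dual reductive pairs*, Israel J. Math. 87 (1994), §3 Thm. 3.1.
* [MoeglinVignerasWaldspurger1987] C. Mœglin, M.-F. Vignéras, J.-L. Waldspurger, LNM 1291 (1987), Chap. 2 II.6.
* [HarrisKudlaSweet1996] M. Harris, S. S. Kudla, W. J. Sweet, J. Amer. Math. Soc. 9 (1996), §1 (1.15).
* [Rangarao1993] R. Ranga Rao, Pacific J. Math. 157 (1993), Lemma 3.2.
-/

set_option autoImplicit false
set_option linter.dupNamespace false -- the mandated namespace repeats `HodgeConjecture.HodgeConjecture`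

noncomputable section

open scoped Matrix Kronecker
open NumberField IsDedekindDomain MeasureTheory MeasureTheory.Measure Matrix
open Literature.RepresentationTheory.HeisenbergGroup Literature.RepresentationTheory.HeisenbergGroup.SymplecticMatrix
open Literature.NumberTheory.Automorphic Literature.NumberTheory.Automorphic.UnitaryGroup Literature.NumberTheory.Weil1964
open Literature.NumberTheory.GaloisRepresentations Literature.NumberTheory.GaloisRepresentations.IsNonarchimedeanLocalField
open Literature.RepresentationTheory.HarrisKudlaSweet1996
open Literature.NumberTheory.GelbartRogawski1991 Literature.NumberTheory.GelbartRogawski1991.GRConstruction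
open Literature.NumberTheory.GelbartRogawski1991.UnitaryDualPair
open Literature.NumberTheory.GelbartRogawski1991.UnitaryDualPair.LocalSplitting
open Literature.NumberTheory.GelbartRogawski1991.AdaptedBlocks
open Literature.NumberTheory.K2Lit.SiegelDoubled
open Summit.HodgeConjecture.HodgeConjecture.Cruxes.HLiu418.K2LiuLocalSWSectionDefs
open Summit.HodgeConjecture.HodgeConjecture.Cruxes.HLiu418.K2LiuLocalSWTensorAdaptedBlocks
open Summit.HodgeConjecture.HodgeConjecture.Cruxes.HLiu418.K2LiuLocalSWTensorBigCellLetters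
open Summit.HodgeConjecture.HodgeConjecture.Cruxes.HLiu418.K2LiuLocalSWBigCellWords
open Summit.HodgeConjecture.HodgeConjecture.Cruxes.HLiu418.K2LiuWitnessUnipotentInvariance

namespace Summit.HodgeConjecture.HodgeConjecture.Cruxes.HLiu418.K2LiuWitnessInvarianceAtTensorDatum

variable (L : Type) [Field L] [NumberField L] [IsCMField L]
variable {N M n : ℕ} (e : Fin N × Fin M ≃ Fin n)
  (dV : Fin N → L) (hdV : ∀ i, IsCMField.complexConj L (dV i) = dV i) (hdV0 : ∀ i, dV i ≠ 0)
  (dW : Fin M → L) (hdW : ∀ i, IsCMField.complexConj L (dW i) = dW i) (hdW0 : ∀ i, dW i ≠ 0)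
variable {M₂ M' n' : ℕ} (eW : Fin M × Fin M₂ ≃ Fin M') (e' : Fin N × Fin M' ≃ Fin n')
  (dV' : Fin M₂ → L) (hdV' : ∀ k, IsCMField.complexConj L (dV' k) = dV' k) (hdV'0 : ∀ k, dV' k ≠ 0)
variable (v : HeightOneSpectrum (𝓞 (Fp L)))
  [MeasurableSpace (v.adicCompletion (Fp L))] [BorelSpace (v.adicCompletion (Fp L))]
  (μ : Measure (v.adicCompletion (Fp L))) [μ.IsAddHaarMeasure]

/-- **`ω_D(n′(T)) Φ = Φ` FROM THE SUPPORT** (big group, any skew `T`): if `ΓΦ` vanishes off `K` and the Rao phase `½⟨x, c_T x⟩` (`c_T = cOfFix 𝕋′ (E′ ι(n′(T)) E′⁻¹)`) lies in the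
conductor `𝔭^{m_ψ}` on `K`, then Kudla's `ω_D(n′(T))` fixes `Φ` (★ F4a-1 word through the implementer `Γ` + ★ (H)). [cite: Kudla1994, §3 Thm. 3.1] [cite: MoeglinVignerasWaldspurger1987, Chap. 2 II.6] -/
theorem localOmega_nElem_eq_self (χ : HeckeCharacter L) (hχ : IsSplittingChar L 1 χ)
    (E' : LocalSp (Fp L) (n' + n') (gramD (Fp L) n' (gramR L e' dV hdV (tensorFrame L dW eW dV') (tensorFrame_real L dW hdW eW dV' hdV'))) v)
    (hE' : (deltaLagrangian (Fp L) v n').map (toLin (Fp L) v E') = lagrangianY (Fp L) (n' + n') v)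
    (Γ : SchwartzBruhat (Fin (n' + n') → v.adicCompletion (Fp L)) ≃ₗ[ℂ] SchwartzBruhat (Fin (n' + n') → v.adicCompletion (Fp L)))
    (hΓ : Implements (localSchrodinger (Fp L) (n' + n') (gramD (Fp L) n' (gramR L e' dV hdV (tensorFrame L dW eW dV') (tensorFrame_real L dW hdW eW dV' hdV'))) v)
      (ofSymplectic _ E') Γ)
    {mψ : ℤ} (hm : (adeleAddCharAt (Fp L) v).HasConductorExp mψ)
    (T : Matrix (Fin n') (Fin n') (LocalRing L v))
    (hT : (T.map (conjLocal L (IsCMField.complexConj L) v))ᵀ * gramS (Fp L) L v n' (gramR L e' dV hdV (tensorFrame L dW eW dV') (tensorFrame_real L dW hdW eW dV' hdV')) +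
      gramS (Fp L) L v n' (gramR L e' dV hdV (tensorFrame L dW eW dV') (tensorFrame_real L dW hdW eW dV' hdV')) * T = 0)
    (Φ : SchwartzBruhat (Fin (n' + n') → v.adicCompletion (Fp L))) {K : Set (Fin (n' + n') → v.adicCompletion (Fp L))}
    (hsupp : ∀ x ∉ K, ((Γ Φ : SchwartzBruhat (Fin (n' + n') → v.adicCompletion (Fp L))) : (Fin (n' + n') → v.adicCompletion (Fp L)) → ℂ) x = 0)
    (hphase : ∀ x ∈ K, halfForm (Matrix.mulVecLin (cOfFix (localGram (Fp L) (n' + n')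
        (gramD (Fp L) n' (gramR L e' dV hdV (tensorFrame L dW eW dV') (tensorFrame_real L dW hdW eW dV' hdV'))) v)
        (E' * iotaD (Fp L) L (IsCMField.complexConj L) (complexConj_imagUnit L) (imagUnit_ne_zero L) (imagUnit_mul_self L) v n'
            (gramR_isSymm L e' dV hdV (tensorFrame L dW eW dV') (tensorFrame_real L dW hdW eW dV' hdV'))
            (hermD_eq_map_gramD L e' dV hdV (tensorFrame L dW eW dV') (tensorFrame_real L dW hdW eW dV' hdV'))
            (nElem (Fp L) L (IsCMField.complexConj L) v n'
              (T₀ := gramR L e' dV hdV (tensorFrame L dW eW dV') (tensorFrame_real L dW hdW eW dV' hdV'))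
              (hermD_eq_map_gramD L e' dV hdV (tensorFrame L dW eW dV') (tensorFrame_real L dW hdW eW dV' hdV')) T hT) * E'⁻¹))) x ∈
      primePowBall (v.adicCompletion (Fp L)) mψ) :
    (localSplittingDatumCM L v μ n' (gramR_isSymm L e' dV hdV (tensorFrame L dW eW dV') (tensorFrame_real L dW hdW eW dV' hdV'))
        (isUnit_det_gramR₀ L e' dV hdV hdV0 (tensorFrame L dW eW dV') (tensorFrame_real L dW hdW eW dV' hdV') (tensorFrame_ne_zero L dW eW dV' hdW0 hdV'0))
        (hermD_eq_map_gramD L e' dV hdV (tensorFrame L dW eW dV') (tensorFrame_real L dW hdW eW dV' hdV')) χ hχ).localOmega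
      (nElem (Fp L) L (IsCMField.complexConj L) v n'
        (T₀ := gramR L e' dV hdV (tensorFrame L dW eW dV') (tensorFrame_real L dW hdW eW dV' hdV'))
        (hermD_eq_map_gramD L e' dV hdV (tensorFrame L dW eW dV') (tensorFrame_real L dW hdW eW dV' hdV')) T hT) Φ = Φ := by
  refine eq_self_of_implementer (isLocallyConstant_of_isContinuousNontrivial (isContinuousNontrivial_adeleAddCharAt (Fp L) v)) Γ _ _ Φ ?_
    (unipOpPi_eq_self_of_support _ hm _ (Γ Φ) hsupp hphase)
  exact implementer_localOmega_nElem_apply L v μ n'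
    (gramR_isSymm L e' dV hdV (tensorFrame L dW eW dV') (tensorFrame_real L dW hdW eW dV' hdV'))
    (isUnit_det_gramR₀ L e' dV hdV hdV0 (tensorFrame L dW eW dV') (tensorFrame_real L dW hdW eW dV' hdV') (tensorFrame_ne_zero L dW eW dV' hdW0 hdV'0))
    (hermD_eq_map_gramD L e' dV hdV (tensorFrame L dW eW dV') (tensorFrame_real L dW hdW eW dV' hdV')) _ E' hE' Γ hΓ T hT
    (fun Ψ => parabolicAtUnipotents_localSplittingDatumCM L v μ n'
      (gramR_isSymm L e' dV hdV (tensorFrame L dW eW dV') (tensorFrame_real L dW hdW eW dV' hdV'))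
      (isUnit_det_gramR₀ L e' dV hdV hdV0 (tensorFrame L dW eW dV') (tensorFrame_real L dW hdW eW dV' hdV') (tensorFrame_ne_zero L dW eW dV' hdW0 hdV'0))
      (hermD_eq_map_gramD L e' dV hdV (tensorFrame L dW eW dV') (tensorFrame_real L dW hdW eW dV' hdV')) χ hχ E' hE' Γ hΓ T hT Ψ) Φ

set_option maxHeartbeats 400000 in
/-- **THE SOCKET BINDER `hf₀inv`, COMPOSED**: on the SMALL group `U(𝔻)(L⁺_v)`, for skew `t` (n × n): if `ΓΦ` vanishes off `K` and the Rao phase of `n′(t ⊗ 1)` lies in `𝔭^{m_ψ}` on `K`,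
then `F_Φ(h · n(t)) = F_Φ(h)` for every `h` (`F_Φ = swSectionTensorLoc … D.localSplitting m₀ Φ`). With `t` ranging over the skew part of `BOX 0` this is the socket's `hf₀inv` for
`N₀ := N_{BOX 0}` (★ F3e), once (W1-b) discharges `hphase` (★ (T3a) + ★ κ-comp (K2) + ★ (Φ8) at `a := c₀ = m_ψ + v(d)`, `b := 0` + ★ `mul_mem_primePowBall_iff`).
[cite: Kudla1994, §3 Thm. 3.1] [cite: HarrisKudlaSweet1996, §1 (1.15)] [cite: MoeglinVignerasWaldspurger1987, Chap. 2 II.6] -/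
theorem swSectionTensorLoc_mul_nElem_eq_self (χ : HeckeCharacter L) (hχ : IsSplittingChar L 1 χ)
    (m₀ : LocalMp (Fp L) (n' + n') (gramD (Fp L) n' (gramR L e' dV hdV (tensorFrame L dW eW dV') (tensorFrame_real L dW hdW eW dV' hdV'))) v)
    (E' : LocalSp (Fp L) (n' + n') (gramD (Fp L) n' (gramR L e' dV hdV (tensorFrame L dW eW dV') (tensorFrame_real L dW hdW eW dV' hdV'))) v)
    (hE' : (deltaLagrangian (Fp L) v n').map (toLin (Fp L) v E') = lagrangianY (Fp L) (n' + n') v)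
    (Γ : SchwartzBruhat (Fin (n' + n') → v.adicCompletion (Fp L)) ≃ₗ[ℂ] SchwartzBruhat (Fin (n' + n') → v.adicCompletion (Fp L)))
    (hΓ : Implements (localSchrodinger (Fp L) (n' + n') (gramD (Fp L) n' (gramR L e' dV hdV (tensorFrame L dW eW dV') (tensorFrame_real L dW hdW eW dV' hdV'))) v)
      (ofSymplectic _ E') Γ)
    {mψ : ℤ} (hm : (adeleAddCharAt (Fp L) v).HasConductorExp mψ)
    (t : Matrix (Fin n) (Fin n) (LocalRing L v))
    (ht : (t.map (conjLocal L (IsCMField.complexConj L) v))ᵀ * gramS (Fp L) L v n (gramR L e dV hdV dW hdW) + gramS (Fp L) L v n (gramR L e dV hdV dW hdW) * t = 0)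
    (Φ : SchwartzBruhat (Fin (n' + n') → v.adicCompletion (Fp L))) {K : Set (Fin (n' + n') → v.adicCompletion (Fp L))}
    (hsupp : ∀ x ∉ K, ((Γ Φ : SchwartzBruhat (Fin (n' + n') → v.adicCompletion (Fp L))) : (Fin (n' + n') → v.adicCompletion (Fp L)) → ℂ) x = 0)
    (hphase : ∀ x ∈ K, halfForm (Matrix.mulVecLin (cOfFix (localGram (Fp L) (n' + n')
        (gramD (Fp L) n' (gramR L e' dV hdV (tensorFrame L dW eW dV') (tensorFrame_real L dW hdW eW dV' hdV'))) v)
        (E' * iotaD (Fp L) L (IsCMField.complexConj L) (complexConj_imagUnit L) (imagUnit_ne_zero L) (imagUnit_mul_self L) v n'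
            (gramR_isSymm L e' dV hdV (tensorFrame L dW eW dV') (tensorFrame_real L dW hdW eW dV' hdV'))
            (hermD_eq_map_gramD L e' dV hdV (tensorFrame L dW eW dV') (tensorFrame_real L dW hdW eW dV' hdV'))
            (nElem (Fp L) L (IsCMField.complexConj L) v n'
              (T₀ := gramR L e' dV hdV (tensorFrame L dW eW dV') (tensorFrame_real L dW hdW eW dV' hdV'))
              (hermD_eq_map_gramD L e' dV hdV (tensorFrame L dW eW dV') (tensorFrame_real L dW hdW eW dV' hdV'))
              (Matrix.reindex (epsV e eW e') (epsV e eW e') (t ⊗ₖ (1 : Matrix (Fin M₂) (Fin M₂) (LocalRing L v))))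
              (skew_reindex_kronecker_one L e dV hdV dW hdW eW e' dV' hdV' v t ht)) * E'⁻¹))) x ∈
      primePowBall (v.adicCompletion (Fp L)) mψ)
    (h : UnitaryGroup.localPi L (IsCMField.complexConj L) (n + n) (hermD L e dV hdV dW hdW) v) :
    swSectionTensorLoc L e dV hdV dW hdW eW e' dV' hdV' v
        (localSplittingDatumCM L v μ n' (gramR_isSymm L e' dV hdV (tensorFrame L dW eW dV') (tensorFrame_real L dW hdW eW dV' hdV'))
          (isUnit_det_gramR₀ L e' dV hdV hdV0 (tensorFrame L dW eW dV') (tensorFrame_real L dW hdW eW dV' hdV') (tensorFrame_ne_zero L dW eW dV' hdW0 hdV'0))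
          (hermD_eq_map_gramD L e' dV hdV (tensorFrame L dW eW dV') (tensorFrame_real L dW hdW eW dV' hdV')) χ hχ).localSplitting
        m₀ Φ
        (h * nElem (Fp L) L (IsCMField.complexConj L) v n (T₀ := gramR L e dV hdV dW hdW) (hermD_eq_map_gramD L e dV hdV dW hdW) t ht) =
      swSectionTensorLoc L e dV hdV dW hdW eW e' dV' hdV' v
        (localSplittingDatumCM L v μ n' (gramR_isSymm L e' dV hdV (tensorFrame L dW eW dV') (tensorFrame_real L dW hdW eW dV' hdV'))
          (isUnit_det_gramR₀ L e' dV hdV hdV0 (tensorFrame L dW eW dV') (tensorFrame_real L dW hdW eW dV' hdV') (tensorFrame_ne_zero L dW eW dV' hdW0 hdV'0))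
          (hermD_eq_map_gramD L e' dV hdV (tensorFrame L dW eW dV') (tensorFrame_real L dW hdW eW dV' hdV')) χ hχ).localSplitting
        m₀ Φ h := by
  have hω := localOmega_nElem_eq_self L dV hdV hdV0 dW hdW hdW0 eW e' dV' hdV' hdV'0 v μ χ hχ E' hE' Γ hΓ hm
    (Matrix.reindex (epsV e eW e') (epsV e eW e') (t ⊗ₖ (1 : Matrix (Fin M₂) (Fin M₂) (LocalRing L v))))
    (skew_reindex_kronecker_one L e dV hdV dW hdW eW e' dV' hdV' v t ht) Φ hsupp hphase
  rw [swSectionTensorLoc_mul_right, tensorEmbLoc_nElem L e dV hdV dW hdW eW e' dV' hdV' v t ht]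
  -- `ω_D u Φ = toRep (s_D u) Φ` definitionally (`localOmega = toRep.comp localSplitting`)
  exact congrArg (fun Ψ => swSectionTensorLoc L e dV hdV dW hdW eW e' dV' hdV' v _ m₀ Ψ h) hω

end Summit.HodgeConjecture.HodgeConjecture.Cruxes.HLiu418.K2LiuWitnessInvarianceAtTensorDatum

end
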